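import Literature.AlgebraicGeometry.HodgeTheory.DiagonalSymmetry
import HarnessLib

/-!
# Coordinate embeddings of projective hypersurfaces: `[z] ↦ [z at the places e, 0 elsewhere]`

Family `hodge`, layer `Literature/AlgebraicGeometry/HodgeTheory`. For an injection
`e : Fin (n₁ + 2) ↪ Fin (n + 2)` of coordinate sets, the **coordinate linear embedding**
`ℙ^{n₁+1}_ℂ ↪ ℙ^{n+1}_ℂ`, `[z] ↦ [ẑ]` with `ẑ_{e i} = zᵢ` and `ẑ_j = 0` for `j ∉ e` (Hartshorne
II Ex. 2.14 (b): the morphism of `Proj` induced by the SURJECTIVE graded homomorphism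
`ℂ[x₀, …, x_{n+1}] → ℂ[x₀, …, x_{n₁+1}]`, `x_{e i} ↦ xᵢ`, `x_j ↦ 0` otherwise — Mathlib `Proj.map`),
and its restriction to hypersurfaces: for forms `F` on `ℙ^{n+1}` and `F₁` on `ℙ^{n₁+1}` with
`F(x̂) = F₁` (e.g. the Fermat forms `Σⱼ xⱼᵐ ↦ Σᵢ xᵢᵐ`, `m ≥ 1`), the **closed sub-hypersurface
morphism** `X_{F₁} ⟶ X_F` over `ℂ` (through the universal property of the reduced induced
structure, as `diagonalAut` / `permAut`). This is the scheme-theoretic form of the sub-Fermat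
varieties `Xʳₘ ≅ Xⁿₘ ∩ {y = 0}`, `Xˢₘ ≅ Xⁿₘ ∩ {x = 0}` of Shioda's inductive structure
(Shioda–Katsura 1979 §1; Shioda, Math. Ann. 245 (1979) §1; da Silva arXiv:2101.04739 Thm. 2.2:
"`Xⁿₘ` 'contains' disjoint unions of `Xᵏₘ` with `k < n`"). PROVED here:

* `embSubst e`, `coordEmbGraded e` — the substitution `x_{e i} ↦ xᵢ`, `x_j ↦ 0` (`j ∉ e`) as a
  graded ring homomorphism `ℂ[x₀, …, x_{n+1}] → ℂ[x₀, …, x_{n₁+1}]`, with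
  `eval z (σ_e G) = eval (extendVec e z) G` (`extendVec e z = ẑ`, Mathlib `Function.extend`);
* `coordProjEmb e : ℙ^{n₁+1}_ℂ ⟶ ℙ^{n+1}_ℂ` over `ℂ` (`Proj.map`; over `Spec ℂ` by the chartwise
  check `coordEmbHom_comp_projToSpec`) and **`map_coordProjEmb_projPoint`: `[z] ↦ [ẑ]` on complex
  points** (both lie in the same basic opens: `[z] ∈ D₊(σ_e G) ↔ G(ẑ) ≠ 0`);
* `hypersurfaceCoordEmb F F₁ hF : X_{F₁} ⟶ X_F` for `σ_e F = F₁`, its continuous map of complex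
  points `coordEmbMap`, and **`hypersurfacePoint_coordEmbMap`: `pt (ι x) = [ẑ]` if `pt x = [z]`**;
* `diagonalMap_comp_coordEmbMap` — **`g_a ∘ ι = ι ∘ g_{a ∘ e}`**: the embedding intertwines the
  diagonal symmetries of `X_F` with those of `X_{F₁}` restricted along `e` (on coordinates
  `a • ẑ = (a ∘ e) • z ̂`), the relation by which `ι^*` carries the eigenspace of a character `χ`
  of a diagonal group to the eigenspace of `χ` restricted along `e` (sequel `FermatSubvariety`).

## Design

No hypothesis on `F`, `F₁` beyond `σ_e F = F₁`. The target and source polynomial rings differ, so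
the graded homomorphism is a `GradedRingHom` between the two degree gradings (Mathlib's
`Proj.map` is stated in this generality); the irrelevant ideal of the source ring is generated by
the images `xᵢ = σ_e(x_{e i})` (`irrelevant_le_map_coordEmbGraded`).

## References

* [Hartshorne1977] R. Hartshorne, Algebraic Geometry (1977), II Ex. 2.14 (b), II Ex. 3.11 (d), II Ex. 3.12.
* [Shioda1979HodgeFermat] T. Shioda, The Hodge conjecture for Fermat varieties, Math. Ann. 245
  (1979) 175–184, §1 (the inductive structure; cite-only).
* [daSilva2021HodgeFermat] G. da Silva Jr., arXiv:2101.04739, Thm. 2.2 (text read).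
-/

noncomputable section

open CategoryTheory AlgebraicGeometry MvPolynomial HomogeneousLocalization
open scoped LinearAlgebra.Projectivization

namespace Literature.AlgebraicGeometry.HodgeTheory

open Literature.AlgebraicGeometry.Motives Literature.NumberTheory.Transcendental

attribute [local instance] MvPolynomial.gradedAlgebra Motives.ProjBaseChange.algebraBase

variable {n₁ n : ℕ}

/-- The grading of the target ring `ℂ[x₀, …, x_{n+1}]` (local notation). [folklore] -/
local notation "𝓐" => MvPolynomial.homogeneousSubmodule (Fin (n + 2)) ℂ
/-- The grading of the source ring `ℂ[x₀, …, x_{n₁+1}]` (local notation). [folklore] -/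
local notation "𝓐₁" => MvPolynomial.homogeneousSubmodule (Fin (n₁ + 2)) ℂ

/-! ### The substitution `x_{e i} ↦ xᵢ`, `x_j ↦ 0` -/

/-- The substitution attached to an injection `e` of coordinate sets: `x_{e i} ↦ xᵢ` and `x_j ↦ 0`
for `j` not in the image (Mathlib `Function.extend e X 0`). [cite: Hartshorne1977, II Ex. 2.14 (b)] -/
def embSubst (e : Fin (n₁ + 2) ↪ Fin (n + 2)) : Fin (n + 2) → MvPolynomial (Fin (n₁ + 2)) ℂ :=
  Function.extend e X 0

/-- `embSubst e (e i) = xᵢ`. [folklore] -/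
@[simp]
theorem embSubst_apply_emb (e : Fin (n₁ + 2) ↪ Fin (n + 2)) (i : Fin (n₁ + 2)) :
    embSubst e (e i) = X i :=
  e.injective.extend_apply _ _ i

/-- `embSubst e j = 0` for `j` outside the image of `e`. [folklore] -/
theorem embSubst_apply_of_not_mem_range (e : Fin (n₁ + 2) ↪ Fin (n + 2)) {j : Fin (n + 2)}
    (hj : j ∉ Set.range e) : embSubst e j = 0 := by
  rw [embSubst, Function.extend_apply' _ _ _ (fun ⟨i, hi⟩ ↦ hj ⟨i, hi⟩), Pi.zero_apply]

/-- The forms `embSubst e j` are linear (a variable or `0`). [folklore] -/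
theorem isHomogeneous_embSubst (e : Fin (n₁ + 2) ↪ Fin (n + 2)) (j : Fin (n + 2)) :
    (embSubst e j).IsHomogeneous 1 := by
  by_cases hj : j ∈ Set.range e
  · obtain ⟨i, rfl⟩ := hj
    rw [embSubst_apply_emb]
    exact isHomogeneous_X ℂ i
  · rw [embSubst_apply_of_not_mem_range e hj]
    exact isHomogeneous_zero _ _ 1

/-- **The vector `ẑ`**: `z` placed at the coordinates `e i`, zero elsewhere
(Mathlib `Function.extend e z 0`). [folklore] -/
def extendVec {R : Type*} [Zero R] (e : Fin (n₁ + 2) ↪ Fin (n + 2)) (z : Fin (n₁ + 2) → R) :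
    Fin (n + 2) → R :=
  Function.extend e z 0

/-- `ẑ_{e i} = zᵢ`. [folklore] -/
@[simp]
theorem extendVec_apply_emb {R : Type*} [Zero R] (e : Fin (n₁ + 2) ↪ Fin (n + 2)) (z : Fin (n₁ + 2) → R)
    (i : Fin (n₁ + 2)) : extendVec e z (e i) = z i :=
  e.injective.extend_apply _ _ i

/-- `ẑ_j = 0` off the image of `e`. [folklore] -/
theorem extendVec_apply_of_not_mem_range {R : Type*} [Zero R] (e : Fin (n₁ + 2) ↪ Fin (n + 2))
    (z : Fin (n₁ + 2) → R) {j : Fin (n + 2)} (hj : j ∉ Set.range e) : extendVec e z j = 0 := by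
  rw [extendVec, Function.extend_apply' _ _ _ (fun ⟨i, hi⟩ ↦ hj ⟨i, hi⟩), Pi.zero_apply]

/-- `ẑ ∘ e = z`. [folklore] -/
@[simp]
theorem extendVec_comp_emb {R : Type*} [Zero R] (e : Fin (n₁ + 2) ↪ Fin (n + 2)) (z : Fin (n₁ + 2) → R) :
    extendVec e z ∘ e = z :=
  funext (extendVec_apply_emb e z)

/-- `ẑ ≠ 0` for `z ≠ 0`. [folklore] -/
theorem extendVec_ne_zero {R : Type*} [Zero R] (e : Fin (n₁ + 2) ↪ Fin (n + 2)) {z : Fin (n₁ + 2) → R}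
    (hz : z ≠ 0) : extendVec e z ≠ 0 := by
  intro h
  apply hz
  rw [← extendVec_comp_emb e z, h]
  rfl

/-- `ẑ` is additive-homogeneous: `(c • z)^ = c • ẑ`. [folklore] -/
theorem extendVec_smul (e : Fin (n₁ + 2) ↪ Fin (n + 2)) (c : ℂ) (z : Fin (n₁ + 2) → ℂ) :
    extendVec e (c • z) = c • extendVec e z := by
  funext j
  by_cases hj : j ∈ Set.range e
  · obtain ⟨i, rfl⟩ := hj
    simp
  · rw [Pi.smul_apply, extendVec_apply_of_not_mem_range e _ hj, extendVec_apply_of_not_mem_range e _ hj,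
      smul_zero]

/-- Diagonal symmetries: `(a • ẑ) = ((a ∘ e) • z)^` — scaling `ẑ` by `a ∈ (ℂˣ)^{n+2}` is extending
the scaling of `z` by the restriction `a ∘ e`. [folklore] -/
theorem smul_extendVec (e : Fin (n₁ + 2) ↪ Fin (n + 2)) (a : Fin (n + 2) → ℂˣ) (z : Fin (n₁ + 2) → ℂ) :
    a • extendVec e z = extendVec e ((fun i ↦ a (e i)) • z) := by
  funext j
  by_cases hj : j ∈ Set.range e
  · obtain ⟨i, rfl⟩ := hj
    simp
  · rw [smul_apply_eq_mul, extendVec_apply_of_not_mem_range e _ hj,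
      extendVec_apply_of_not_mem_range e _ hj, mul_zero]

/-- **`(σ_e G)(z) = G(ẑ)`**: substituting and evaluating at `z` is evaluating at `ẑ`. [folklore] -/
theorem eval_aeval_embSubst (e : Fin (n₁ + 2) ↪ Fin (n + 2)) (z : Fin (n₁ + 2) → ℂ)
    (G : MvPolynomial (Fin (n + 2)) ℂ) :
    MvPolynomial.eval z (aeval (embSubst e) G) = MvPolynomial.eval (extendVec e z) G := by
  have h : (fun j ↦ aeval z (embSubst e j)) = extendVec e z := by
    funext j
    by_cases hj : j ∈ Set.range e
    · obtain ⟨i, rfl⟩ := hj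
      simp
    · rw [embSubst_apply_of_not_mem_range e hj, extendVec_apply_of_not_mem_range e z hj, map_zero]
  change aeval z (aeval (embSubst e) G) = aeval (extendVec e z) G
  rw [← AlgHom.comp_apply, MvPolynomial.comp_aeval, h]

/-! ### The graded homomorphism and the morphism of projective spaces -/

/-- **`σ_e : ℂ[x₀, …, x_{n+1}] → ℂ[x₀, …, x_{n₁+1}]` as a graded ring homomorphism** (it is
`aeval (embSubst e)`, degree-preserving since the `embSubst e j` are linear).
[cite: Hartshorne1977, II Ex. 2.14 (b)] -/
def coordEmbGraded (e : Fin (n₁ + 2) ↪ Fin (n + 2)) : 𝓐 →+*ᵍ 𝓐₁ where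
  __ := (aeval (embSubst e) : MvPolynomial (Fin (n + 2)) ℂ →ₐ[ℂ] MvPolynomial (Fin (n₁ + 2)) ℂ).toRingHom
  map_mem {i x} hx := by
    have h := ((mem_homogeneousSubmodule i x).mp hx).aeval (embSubst e) (isHomogeneous_embSubst e)
    rw [one_mul] at h
    exact (mem_homogeneousSubmodule i _).mpr h

/-- `coordEmbGraded e` is `aeval (embSubst e)` on elements (`rfl`). [folklore] -/
@[simp]
theorem coordEmbGraded_apply (e : Fin (n₁ + 2) ↪ Fin (n + 2)) (p : MvPolynomial (Fin (n + 2)) ℂ) :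
    coordEmbGraded e p = aeval (embSubst e) p := rfl

/-- `σ_e` fixes the constants. [folklore] -/
theorem coordEmbGraded_C (e : Fin (n₁ + 2) ↪ Fin (n + 2)) (c : ℂ) :
    coordEmbGraded e (C c) = C c := by
  rw [coordEmbGraded_apply, aeval_C, MvPolynomial.algebraMap_eq]

open HomogeneousIdeal in
/-- **The irrelevant ideal of the source is generated by the image of that of the target**:
`xᵢ = σ_e(x_{e i})` (the hypothesis of Mathlib's `Proj.map`; `σ_e` is surjective).
[cite: Hartshorne1977, II Ex. 2.14 (b)] -/
theorem irrelevant_le_map_coordEmbGraded (e : Fin (n₁ + 2) ↪ Fin (n + 2)) :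
    HomogeneousIdeal.irrelevant 𝓐₁ ≤ (HomogeneousIdeal.irrelevant 𝓐).map (coordEmbGraded e) := by
  rw [← toIdeal_le_toIdeal_iff, irrelevant_eq_span, Ideal.span_le, toIdeal_map]
  intro x hx
  simp only [Set.mem_iUnion, SetLike.mem_coe, exists_prop] at hx
  obtain ⟨i, hi, hx⟩ := hx
  -- `x = σ_e (rename e x)`: `σ_e` is surjective
  have hre : rename e x ∈ 𝓐 i :=
    (mem_homogeneousSubmodule i _).mpr (((mem_homogeneousSubmodule i x).mp hx).rename_isHomogeneous)
  have hx' : x = coordEmbGraded e (rename e x) := by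
    rw [coordEmbGraded_apply, aeval_rename, show embSubst e ∘ e = X from funext (embSubst_apply_emb e),
      aeval_X_left_apply]
  rw [SetLike.mem_coe, hx']
  exact Ideal.mem_map_of_mem _ (mem_irrelevant_of_mem _ hi hre)

/-- **The coordinate embedding `ℙ^{n₁+1}_ℂ → ℙ^{n+1}_ℂ` as a morphism of schemes** (Mathlib
`Proj.map` of `σ_e`). [cite: Hartshorne1977, II Ex. 2.14 (b)] -/
def coordEmbHom (e : Fin (n₁ + 2) ↪ Fin (n + 2)) : Proj 𝓐₁ ⟶ Proj 𝓐 :=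
  Proj.map (coordEmbGraded e) (irrelevant_le_map_coordEmbGraded e)

/-- On `ℂ[x]_{(s)} → ℂ[x']_{(σ_e s)}` the map of homogeneous localizations induced by `σ_e`
(Mathlib `Away.map`) is compatible with the `ℂ`-algebra structures. [folklore] -/
theorem awayMap_coordEmbGraded_algebraMap (e : Fin (n₁ + 2) ↪ Fin (n + 2)) (s : MvPolynomial (Fin (n + 2)) ℂ)
    (c : ℂ) :
    Away.map (coordEmbGraded e) s (algebraMap ℂ (Away 𝓐 s) c) =
      algebraMap ℂ (Away 𝓐₁ (coordEmbGraded e s)) c := by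
  apply HomogeneousLocalization.val_injective
  rw [ProjBaseChange.val_algebraMap, ProjBaseChange.algebraMap_eq', Away.map,
    HomogeneousLocalization.map_mk, HomogeneousLocalization.val_mk]
  change Localization.mk (coordEmbGraded e ↑(algebraMap ℂ (𝓐 0) c)) ⟨coordEmbGraded e 1, _⟩ = _
  simp only [SetLike.GradeZero.coe_algebraMap, MvPolynomial.algebraMap_eq, coordEmbGraded_C, map_one]
  rw [← MvPolynomial.algebraMap_eq]
  change Localization.mk (algebraMap ℂ (MvPolynomial (Fin (n₁ + 2)) ℂ) c) 1 =
    algebraMap ℂ (Localization.Away (coordEmbGraded e s)) c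
  rw [Localization.mk_algebraMap]

/-- On the chart `D₊(σ_e s) → D₊(s)` the embedding is `Spec (Away.map σ_e s)`, a morphism over
`Spec ℂ` (Mathlib `Proj.awayι_comp_map`). [folklore] -/
theorem awayι_comp_coordEmbHom_comp_projToSpec (e : Fin (n₁ + 2) ↪ Fin (n + 2)) {i : ℕ} (hi : 0 < i)
    (s : MvPolynomial (Fin (n + 2)) ℂ) (hs : s ∈ 𝓐 i) :
    Proj.awayι 𝓐₁ (coordEmbGraded e s) ((coordEmbGraded e).map_mem hs) hi ≫ coordEmbHom e ≫
        ProjBaseChangeRing.projToSpec (Fin (n + 2)) ℂ =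
      Proj.awayι 𝓐₁ (coordEmbGraded e s) ((coordEmbGraded e).map_mem hs) hi ≫
        ProjBaseChangeRing.projToSpec (Fin (n₁ + 2)) ℂ := by
  rw [coordEmbHom, Proj.awayι_comp_map_assoc _ _ hi s hs, ProjBaseChangeRing.awayι_projToSpec,
    ProjBaseChangeRing.awayι_projToSpec, ← Spec.map_comp, ← CommRingCat.ofHom_comp]
  congr 2
  exact RingHom.ext fun c ↦ awayMap_coordEmbGraded_algebraMap e s c

/-- **`coordEmbHom e` is a morphism over `Spec ℂ`** (checked on the open cover of the source by the
`D₊(σ_e s)`, Mathlib `Proj.mapAffineOpenCover`). [folklore] -/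
theorem coordEmbHom_comp_projToSpec (e : Fin (n₁ + 2) ↪ Fin (n + 2)) :
    coordEmbHom e ≫ ProjBaseChangeRing.projToSpec (Fin (n + 2)) ℂ =
      ProjBaseChangeRing.projToSpec (Fin (n₁ + 2)) ℂ := by
  refine (Proj.mapAffineOpenCover (coordEmbGraded e)
    (irrelevant_le_map_coordEmbGraded e)).openCover.hom_ext _ _ fun s ↦ ?_
  rw [Scheme.AffineOpenCover.openCover_f, Proj.mapAffineOpenCover_f]
  exact awayι_comp_coordEmbHom_comp_projToSpec e s.1.2 s.2 s.2.2

/-- **The coordinate embedding `ℙ^{n₁+1}_ℂ ⟶ ℙ^{n+1}_ℂ` over `ℂ`**, `[z] ↦ [ẑ]`.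
[cite: Hartshorne1977, II Ex. 2.14 (b)] -/
def coordProjEmb (e : Fin (n₁ + 2) ↪ Fin (n + 2)) :
    Motives.projectiveSpace (n₁ + 1) ℂ ⟶ Motives.projectiveSpace (n + 1) ℂ :=
  Over.homMk (coordEmbHom e) (coordEmbHom_comp_projToSpec e)

/-- The underlying morphism of `coordProjEmb e` is `Proj.map σ_e` (`rfl`). [folklore] -/
@[simp]
theorem coordProjEmb_left (e : Fin (n₁ + 2) ↪ Fin (n + 2)) : (coordProjEmb e).left = coordEmbHom e := rfl

/-- `coordProjEmb e` pulls `D₊(s)` back to `D₊(σ_e s)` (Mathlib `Proj.map_preimage_basicOpen`). [folklore] -/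
theorem coordProjEmb_preimage_basicOpen (e : Fin (n₁ + 2) ↪ Fin (n + 2)) (s : MvPolynomial (Fin (n + 2)) ℂ) :
    (coordProjEmb e).left ⁻¹ᵁ Proj.basicOpen 𝓐 s = Proj.basicOpen 𝓐₁ (aeval (embSubst e) s) :=
  rfl

/-- `σ_e` preserves degrees. [folklore] -/
theorem aeval_embSubst_mem (e : Fin (n₁ + 2) ↪ Fin (n + 2)) {m : ℕ} {s : MvPolynomial (Fin (n + 2)) ℂ}
    (hs : s ∈ 𝓐 m) : aeval (embSubst e) s ∈ 𝓐₁ m :=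
  (coordEmbGraded e).map_mem hs

/-- **On complex points the coordinate embedding is `[z] ↦ [ẑ]`**: the `ℂ`-point of `ℙ^{n₁+1}_ℂ`
with homogeneous coordinates `v` goes to the point of `ℙ^{n+1}_ℂ` with homogeneous coordinates
`v̂` (`[v] ∈ D₊(σ_e f) ↔ (σ_e f)(v) ≠ 0 ↔ f(v̂) ≠ 0`). [cite: Hartshorne1977, II Ex. 2.14 (b)] -/
theorem map_coordProjEmb_projPoint (e : Fin (n₁ + 2) ↪ Fin (n + 2)) (v : Fin (n₁ + 2) → ℂ) (hv : v ≠ 0) :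
    AlgPoints.map (coordProjEmb e) (projPoint (n₁ + 1) (Projectivization.mk ℂ v hv)) =
      projPoint (n + 1) (Projectivization.mk ℂ (extendVec e v) (extendVec_ne_zero e hv)) := by
  refine ComplexPoints.ext_of_pt_eq ?_
  rw [AlgPoints.pt_map, projPoint_mk, projPoint_mk]
  refine Proj.ext_of_forall_mem_basicOpen_iff 𝓐 fun m hm f hf ↦ ?_
  change (pointOfVec (n₁ + 1) v hv).pt ∈ (coordProjEmb e).left ⁻¹ᵁ Proj.basicOpen 𝓐 f ↔ _
  rw [coordProjEmb_preimage_basicOpen]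
  refine (pt_pointOfVec_mem_basicOpen_iff (n₁ + 1) v hv hm (aeval_embSubst_mem e hf)).trans ?_
  rw [eval_aeval_embSubst]
  exact (pt_pointOfVec_mem_basicOpen_iff (n + 1) _ _ hm hf).symm

/-! ### The closed sub-hypersurface morphism `X_{F₁} ⟶ X_F` -/

section Hypersurface

variable (F : MvPolynomial (Fin (n + 2)) ℂ) (F₁ : MvPolynomial (Fin (n₁ + 2)) ℂ) {e : Fin (n₁ + 2) ↪ Fin (n + 2)}

/-- For `σ_e F = F₁`, the coordinate embedding maps `V₊(F₁)` into `V₊(F)` (it pulls `D₊(F)` back to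
`D₊(σ_e F) = D₊(F₁)`). [cite: Hartshorne1977, II Ex. 2.14 (b)] -/
theorem range_ι_comp_coordProjEmb_subset (hF : aeval (embSubst e) F = F₁) :
    Set.range ((SmoothHypersurface.hypersurfaceι F₁).left ≫ (coordProjEmb e).left) ⊆
      Set.range (SmoothHypersurface.hypersurfaceι F).left := by
  rintro _ ⟨x, rfl⟩
  have hx : (SmoothHypersurface.hypersurfaceι F₁).left x ∈ ProjectiveSpectrum.zeroLocus 𝓐₁ {F₁} :=
    (Set.ext_iff.mp (SmoothHypersurface.range_hypersurfaceι F₁) _).mp ⟨x, rfl⟩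
  rw [mem_zeroLocus_iff_notMem_basicOpen] at hx
  refine (Set.ext_iff.mp (SmoothHypersurface.range_hypersurfaceι F) _).mpr
    ((mem_zeroLocus_iff_notMem_basicOpen F _).mpr fun h ↦ hx ?_)
  have h' : (SmoothHypersurface.hypersurfaceι F₁).left x ∈ (coordProjEmb e).left ⁻¹ᵁ Proj.basicOpen 𝓐 F := h
  rwa [coordProjEmb_preimage_basicOpen, hF] at h'

/-- **The closed sub-hypersurface morphism `X_{F₁} ⟶ X_F` over `ℂ`** attached to a coordinate
embedding `e` with `σ_e F = F₁`: the restriction of `[z] ↦ [ẑ]` to `V₊(F₁)`, lifted to the reduced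
closed subscheme `X_F` by the universal property of the reduced induced structure
(`Motives.liftOfRangeSubset`). For the Fermat forms these are the sub-Fermat varieties
`Xᵏₘ ⊂ Xⁿₘ` of Shioda's inductive structure. [cite: Hartshorne1977, II Ex. 3.11 (d)]
[cite: daSilva2021HodgeFermat, Thm. 2.2] -/
def hypersurfaceCoordEmb (hF : aeval (embSubst e) F = F₁) :
    SmoothHypersurface.hypersurface F₁ ⟶ SmoothHypersurface.hypersurface F :=
  Over.homMk (liftOfRangeSubset (SmoothHypersurface.hypersurfaceι F).left
    ((SmoothHypersurface.hypersurfaceι F₁).left ≫ (coordProjEmb e).left)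
    (range_ι_comp_coordProjEmb_subset F F₁ hF)) (by
      rw [← Over.w (SmoothHypersurface.hypersurfaceι F), liftOfRangeSubset_comp_assoc, Category.assoc,
        Over.w (coordProjEmb e), Over.w (SmoothHypersurface.hypersurfaceι F₁)])

/-- `hypersurfaceCoordEmb` followed by the embedding of `X_F` is the embedding of `X_{F₁}` followed
by `[z] ↦ [ẑ]` (underlying schemes). [folklore] -/
@[reassoc]
theorem hypersurfaceCoordEmb_left_comp_ι (hF : aeval (embSubst e) F = F₁) :
    (hypersurfaceCoordEmb F F₁ hF).left ≫ (SmoothHypersurface.hypersurfaceι F).left =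
      (SmoothHypersurface.hypersurfaceι F₁).left ≫ (coordProjEmb e).left :=
  liftOfRangeSubset_comp _ _ (range_ι_comp_coordProjEmb_subset F F₁ hF)

/-- The same over `ℂ`. [folklore] -/
@[reassoc]
theorem hypersurfaceCoordEmb_comp_ι (hF : aeval (embSubst e) F = F₁) :
    hypersurfaceCoordEmb F F₁ hF ≫ SmoothHypersurface.hypersurfaceι F =
      SmoothHypersurface.hypersurfaceι F₁ ≫ coordProjEmb e := by
  ext : 1
  rw [Over.comp_left, Over.comp_left]
  exact hypersurfaceCoordEmb_left_comp_ι F F₁ hF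

/-- **The continuous map `ι : X_{F₁}(ℂ) → X_F(ℂ)` of complex points** induced by the
sub-hypersurface morphism (`Motives.AlgPoints.mapContinuous`). [cite: daSilva2021HodgeFermat, Thm. 2.2] -/
def coordEmbMap (hF : aeval (embSubst e) F = F₁) :
    C(ComplexPoints (SmoothHypersurface.hypersurface F₁), ComplexPoints (SmoothHypersurface.hypersurface F)) :=
  AlgPoints.mapContinuous (hypersurfaceCoordEmb F F₁ hF)

/-- `coordEmbMap` is the map on `ℂ`-points of `hypersurfaceCoordEmb` (`rfl`). [folklore] -/
theorem coordEmbMap_apply (hF : aeval (embSubst e) F = F₁) (x : ComplexPoints (SmoothHypersurface.hypersurface F₁)) :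
    coordEmbMap F F₁ hF x = AlgPoints.map (hypersurfaceCoordEmb F F₁ hF) x := rfl

/-- **`ι` acts as `z ↦ ẑ` on homogeneous coordinates**: if `pt x = [z]` then `pt (ι x) = [ẑ]`.
[cite: Hartshorne1977, II Ex. 2.14 (b)] -/
theorem hypersurfacePoint_coordEmbMap (hF : aeval (embSubst e) F = F₁)
    (x : ComplexPoints (SmoothHypersurface.hypersurface F₁)) :
    hypersurfacePoint (SmoothHypersurface.hypersurfaceι F) (coordEmbMap F F₁ hF x) =
      Projectivization.mk ℂ (extendVec e (hypersurfacePoint (SmoothHypersurface.hypersurfaceι F₁) x).rep)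
        (extendVec_ne_zero e (Projectivization.rep_nonzero _)) := by
  refine hypersurfacePoint_eq_of_projPoint_eq _ _ ?_
  rw [← map_coordProjEmb_projPoint e _ (Projectivization.rep_nonzero _), Projectivization.mk_rep,
    projPoint_hypersurfacePoint, coordEmbMap_apply]
  change _ = (AlgPoints.map (SmoothHypersurface.hypersurfaceι F) ∘ AlgPoints.map (hypersurfaceCoordEmb F F₁ hF)) x
  rw [← AlgPoints.map_comp, hypersurfaceCoordEmb_comp_ι, AlgPoints.map_comp, Function.comp_apply]

/-- The coordinate description on chosen representatives: `rep (pt (ι x)) = t • (rep (pt x))^` for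
some scalar `t`. [folklore] -/
theorem exists_rep_hypersurfacePoint_coordEmbMap (hF : aeval (embSubst e) F = F₁)
    (x : ComplexPoints (SmoothHypersurface.hypersurface F₁)) :
    ∃ t : ℂ, (hypersurfacePoint (SmoothHypersurface.hypersurfaceι F) (coordEmbMap F F₁ hF x)).rep =
      t • extendVec e (hypersurfacePoint (SmoothHypersurface.hypersurfaceι F₁) x).rep := by
  rw [hypersurfacePoint_coordEmbMap]
  obtain ⟨u, hu⟩ := Projectivization.exists_smul_eq_mk_rep ℂ
    (extendVec e (hypersurfacePoint (SmoothHypersurface.hypersurfaceι F₁) x).rep)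
    (extendVec_ne_zero e (Projectivization.rep_nonzero _))
  exact ⟨u, by rw [← hu, Units.smul_def]⟩

/-- **`ι` is injective on complex points** (`ẑ` determines `z = ẑ ∘ e`). [folklore] -/
theorem coordEmbMap_injective (hF : aeval (embSubst e) F = F₁) : Function.Injective (coordEmbMap F F₁ hF) := by
  intro x y hxy
  apply (isEmbedding_hypersurfacePoint (SmoothHypersurface.hypersurfaceι F₁)).injective
  have h := congrArg (hypersurfacePoint (SmoothHypersurface.hypersurfaceι F)) hxy
  rw [hypersurfacePoint_coordEmbMap, hypersurfacePoint_coordEmbMap, Projectivization.mk_eq_mk_iff'] at h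
  obtain ⟨t, ht⟩ := h
  rw [← Projectivization.mk_rep (hypersurfacePoint (SmoothHypersurface.hypersurfaceι F₁) x),
    ← Projectivization.mk_rep (hypersurfacePoint (SmoothHypersurface.hypersurfaceι F₁) y),
    Projectivization.mk_eq_mk_iff']
  refine ⟨t, ?_⟩
  have h1 : (t • extendVec e (hypersurfacePoint (SmoothHypersurface.hypersurfaceι F₁) y).rep) ∘ e =
      t • (hypersurfacePoint (SmoothHypersurface.hypersurfaceι F₁) y).rep := by
    funext i
    simp
  rw [← h1, ht, extendVec_comp_emb]

/-! ### The embedding intertwines the diagonal symmetries -/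

/-- **`g_a ∘ ι = ι ∘ g_{a ∘ e}`**: for `a` in the diagonal stabiliser of `F` whose restriction
`a ∘ e` lies in that of `F₁`, scaling after embedding is embedding after scaling by the restriction
(on coordinates `a • ẑ = ((a ∘ e) • z)^`, `smul_extendVec`). [cite: Shioda1979HodgeFermat, §1]
[cite: daSilva2021HodgeFermat, Thm. 2.2 (a) (G-equivariance)] -/
theorem diagonalMap_comp_coordEmbMap (hF : aeval (embSubst e) F = F₁) {a : Fin (n + 2) → ℂˣ}
    (ha : a ∈ diagonalStabilizer F) (hae : (fun i ↦ a (e i)) ∈ diagonalStabilizer F₁) :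
    (diagonalMap F ha).comp (coordEmbMap F F₁ hF) = (coordEmbMap F F₁ hF).comp (diagonalMap F₁ hae) := by
  refine ContinuousMap.coe_injective (funext fun x ↦ ?_)
  apply (isEmbedding_hypersurfacePoint (SmoothHypersurface.hypersurfaceι F)).injective
  rw [ContinuousMap.comp_apply, ContinuousMap.comp_apply, hypersurfacePoint_diagonalMap,
    hypersurfacePoint_coordEmbMap F F₁ hF (diagonalMap F₁ hae x), Projectivization.mk_eq_mk_iff']
  obtain ⟨t, ht⟩ := exists_rep_hypersurfacePoint_coordEmbMap F F₁ hF x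
  obtain ⟨s, hs⟩ := exists_rep_hypersurfacePoint_diagonalMap F₁ hae x
  have hs0 : s ≠ 0 := by
    intro hs0
    refine Projectivization.rep_nonzero
      (hypersurfacePoint (SmoothHypersurface.hypersurfaceι F₁) (diagonalMap F₁ hae x)) ?_
    rw [hs, hs0, zero_smul]
  refine ⟨t * s⁻¹, ?_⟩
  rw [ht, hs, extendVec_smul, ← smul_extendVec, smul_smul, mul_assoc, inv_mul_cancel₀ hs0, mul_one]
  funext j
  simp only [Pi.smul_apply, smul_eq_mul, smul_apply_eq_mul]
  ring

end Hypersurface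

end Literature.AlgebraicGeometry.HodgeTheory

end
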